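import Literature.AlgebraicGeometry.Motives.HirschowitzIyerQuadricCubicGysin
import Literature.AlgebraicGeometry.Motives.ProjectiveSpaceFormSectionOfPlane
import HarnessLib

/-!
# Strong planes: the Gysin map of `V₊(Q, C) ⊂ V₊(Q)` sends a strong `2`-plane to a positive multiple
# of its line (Hirschowitz–Iyer, Lemma 2.2, case `s = r = 1`)

Hirschowitz–Iyer, Contemp. Math. 522 (2010), §2, proof of Lemma 2.2, case `s = r`: "`W` is a strong
`r`-plane. This gives us a strong `(r+1)`-plane in `Y'` which we take for `Γ`. Indeed, we have
`Γ · Y = d W`." For the pair `Y = V₊(Q, C) ⊂ Y' = V₊(Q)` in `ℙⁿ` and the Gysin map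
`quadricCubicGysin : CH_{d+1}(V₊(Q)) → CH_d(V₊(Q, C))` (`Motives/HirschowitzIyerQuadricCubicGysin`):
if `Π ⊆ V₊(Q)` is an `(r+1)`-plane (`IsLinearSubspacePoint`, `Motives/LinearSubspacesGenerateChow`)
with `Π ∩ V₊(C) = Π ∩ V₊(ℓ)` set-theoretically for a linear form `ℓ` with `Π ⊄ V₊(ℓ)` (a strong
plane not contained in `Y`), then **`Γ · Y = a • [Π ∩ V₊(ℓ)]` with `a > 0`**, the `r`-plane
`Π ∩ V₊(ℓ) ⊆ Y`:

* `quadricCubic_gysinCycle_primeCycle_eq_smul` (cycle level), `quadricCubicGysin_mk_primeCycle_eq_smul`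
  (in `CH`).

Ingredients: the section of a plane of `ℙⁿ` by `V₊(C)`
(`ProjSpace.exists_primeInter_formDivisor_eq_smul_of_zeroLocus_inter_eq`,
`Motives/ProjectiveSpaceFormSectionOfPlane`), its transport to `V₊(Q)` along the closed immersion
(`CartierDivisor.map_primeInter_pullbackAvoiding`, `Motives/CartierDivisorIntersectionSubvariety`), and
restriction to `V₊(Q, C)`. Everything is proved; no named facts.

## References

* A. Hirschowitz, J. N. Iyer, Contemp. Math. 522 (2010), §2, Lemma 2.2. [HirschowitzIyer2010]
* W. Fulton, *Intersection Theory*, 2nd ed. (1998), Def. 2.3, Prop. 2.3 (c). [Fulton1998]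
-/

noncomputable section

universe u

open CategoryTheory AlgebraicGeometry Order Topology TopologicalSpace
open Literature.AlgebraicGeometry.Motives.Segre Literature.AlgebraicGeometry.Motives.RatFn

attribute [local instance] MvPolynomial.gradedAlgebra

namespace Literature.AlgebraicGeometry.Motives

/-! ### Linear-subspace points along closed immersions -/

section Transport

variable {k : Type u} [Field k] {N r : ℕ}

/-- A closed continuous map takes `closure {z}` onto `closure {f z}`. [folklore] -/
theorem image_closure_singleton_of_isClosedMap {X Y : Scheme.{u}} (f : X ⟶ Y) (hf : IsClosedMap f.base)
    (z : X) : f.base '' closure {z} = closure {f.base z} := by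
  apply subset_antisymm
  · simpa using image_closure_subset_closure_image (s := {z}) f.base.hom.continuous
  · exact closure_minimal (Set.singleton_subset_iff.2 ⟨z, subset_closure rfl, rfl⟩) (hf _ isClosed_closure)

/-- **Linear-subspace points are seen in `ℙᴺ`**: `z ∈ X` is an `r`-plane point w.r.t. a closed
`k`-immersion `i : X ↪ ℙᴺ` iff `i z` is an `r`-plane point of `ℙᴺ` (w.r.t. `𝟙`). [folklore] -/
theorem isLinearSubspacePoint_iff_base {X : SchemeOver k} (i : X ⟶ projectiveSpace N k)
    [IsClosedImmersion i.left] (z : ↥X.left) :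
    IsLinearSubspacePoint r N i z ↔ IsLinearSubspacePoint r N (𝟙 (projectiveSpace N k)) (i.left z) := by
  have himg : ⇑i.left.base '' closure {z} = closure {i.left.base z} :=
    image_closure_singleton_of_isClosedMap i.left i.left.isClosedMap z
  have hht : height (i.left.base z) = height z := height_base_eq_of_isClosedImmersion' i.left z
  simp only [isLinearSubspacePoint_iff, hht, himg]
  constructor
  · rintro ⟨h1, L, hL, hhom, hcl⟩
    exact ⟨h1, L, hL, hhom, by change id '' closure {i.left.base z} = _; rw [Set.image_id]; exact hcl⟩
  · rintro ⟨h1, L, hL, hhom, hcl⟩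
    refine ⟨h1, L, hL, hhom, ?_⟩
    change id '' closure {i.left.base z} = _ at hcl
    rwa [Set.image_id] at hcl

end Transport

/-! ### Sections of planes of `V₊(Q)` by hypersurfaces -/

section StrongPlane

variable {n : ℕ} {K : Type u} [Field K] {Q C : MvPolynomial (Fin (n + 1)) K}
  [IsIntegral (quadric Q).left] {e : ℕ}

/-- **The section of an `r`-plane `Π ⊆ V₊(Q)` by a hypersurface `V₊(F)` meeting it in `Π ∩ V₊(ℓ)`**,
computed on `V₊(Q)`: for an `r`-plane point `w` of `V₊(Q)`, a form `F` of degree `e ≥ 1` not vanishing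
on `V₊(Q)` and a linear form `ℓ ∉ 𝔭_w` with `Π ∩ V₊(F) = Π ∩ V₊(ℓ)` set-theoretically,
`V₊(F)|_{V₊(Q)} · [closure {w}] = a • [closure {w₁}]` for the `(r-1)`-plane point `w₁` of `V₊(Q)` with
`closure {w₁} = Π ∩ V₊(ℓ)` and some `a > 0` (the `ℙⁿ` statement
`ProjSpace.exists_primeInter_formDivisor_eq_smul_of_zeroLocus_inter_eq` transported along
`V₊(Q) ↪ ℙⁿ`, `CartierDivisor.map_primeInter_pullbackAvoiding`).
[cite: HirschowitzIyer2010, §2 Lemma 2.2 (case s = r)] -/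
theorem quadric_primeInter_formDivisor_eq_smul (he : 0 < e) {F : MvPolynomial (Fin (n + 1)) K}
    (hF : F ∈ grading (Fin (n + 1)) K e) (hF0 : F ≠ 0)
    (hFη : (ProjSpace.formDivisor F hF hF0).Avoids (quadricι Q (genericPoint (quadric Q).left)))
    {r : ℕ} (hr : 1 ≤ r) {w : ↥(quadric Q).left}
    (hw : IsLinearSubspacePoint r n (completeIntersectionι (fun _ : Fin 1 => Q)) w)
    {ℓ : MvPolynomial (Fin (n + 1)) K} (hℓ : ℓ ∈ grading (Fin (n + 1)) K 1)
    (hℓw : ℓ ∉ (quadricι Q w).asHomogeneousIdeal)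
    (hFℓ : closure {quadricι Q w} ∩
        ProjectiveSpectrum.zeroLocus (MvPolynomial.homogeneousSubmodule (Fin (n + 1)) K) {F} =
      closure {quadricι Q w} ∩
        ProjectiveSpectrum.zeroLocus (MvPolynomial.homogeneousSubmodule (Fin (n + 1)) K) {ℓ}) :
    ∃ (w₁ : ↥(quadric Q).left) (a : ℤ),
      IsLinearSubspacePoint (r - 1) n (completeIntersectionι (fun _ : Fin 1 => Q)) w₁ ∧ 0 < a ∧
        ((ProjSpace.formDivisor F hF hF0).pullbackAvoiding (quadricι Q) hFη).primeInter w =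
          a • primeCycle w₁ ∧
        closure {quadricι Q w₁} = closure {quadricι Q w} ∩
          ProjectiveSpectrum.zeroLocus (MvPolynomial.homogeneousSubmodule (Fin (n + 1)) K) {ℓ} := by
  classical
  set ι := completeIntersectionι (fun _ : Fin 1 => Q) with hιdef
  set DF := (ProjSpace.formDivisor F hF hF0).pullbackAvoiding (quadricι Q) hFη with hDF
  -- in `ℙⁿ`
  have hw' : IsLinearSubspacePoint r n (𝟙 (projectiveSpace n K)) (ι.left w) :=
    (isLinearSubspacePoint_iff_base ι w).1 hw
  obtain ⟨w', a, hw'lin, ha, hsec, hclw'⟩ :=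
    ProjSpace.exists_primeInter_formDivisor_eq_smul_of_zeroLocus_inter_eq hr hw' hℓ hℓw he hF hF0 hFℓ
  -- `F ∉ 𝔭_w`
  have hFw : F ∉ (quadricι Q w).asHomogeneousIdeal := by
    intro h
    have hmem : quadricι Q w ∈ closure {quadricι Q w} ∩
        ProjectiveSpectrum.zeroLocus (MvPolynomial.homogeneousSubmodule (Fin (n + 1)) K) {F} :=
      ⟨subset_closure (Set.mem_singleton _),
        (ProjectiveSpectrum.mem_zeroLocus _ _ _).2 (Set.singleton_subset_iff.2 h)⟩
    rw [hFℓ] at hmem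
    exact hℓw (Set.singleton_subset_iff.1 ((ProjectiveSpectrum.mem_zeroLocus _ _ _).1 hmem.2))
  -- transport to `V₊(Q)`: `ι_*(DF · [closure {w}]) = V₊(F) · [Π] = a • [closure w']`
  have hmap : AlgebraicCycle.map ι.left height height (DF.primeInter w) =
      (ProjSpace.formDivisor F hF hF0).primeInter (X := projectiveSpace n K) (ι.left w) :=
    CartierDivisor.map_primeInter_pullbackAvoiding (X := projectiveSpace n K) ι
      (ProjSpace.isEffective_formDivisor hF hF0) _
      ((ProjSpace.formDivisor_avoids_iff hF hF0 he).2 hFw)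
  rw [hsec] at hmap
  -- `w' ∈ Π ⊆ V₊(Q)`: `w' = ι w₁`
  have hw'cl : w' ∈ closure {ι.left w} := by
    have h := (subset_closure (Set.mem_singleton w') : w' ∈ closure {w'})
    rw [hclw'] at h
    exact h.1
  have hsub : closure {ι.left w} ⊆ Set.range ι.left := closure_minimal
    (Set.singleton_subset_iff.2 ⟨w, rfl⟩) ι.left.isClosedEmbedding.isClosed_range
  obtain ⟨w₁, hw₁⟩ := hsub hw'cl
  have hprime : DF.primeInter w = a • primeCycle w₁ := by
    have h1 := congrArg (cycleRestrictClosed ι.left) hmap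
    rw [cycleRestrictClosed_map] at h1
    rw [h1]
    ext x
    rw [cycleRestrictClosed_apply, Function.locallyFinsuppWithin.coe_zsmul, Pi.smul_apply,
      Function.locallyFinsuppWithin.coe_zsmul, Pi.smul_apply]
    congr 1
    by_cases hx : x = w₁
    · subst hx
      rw [primeCycle_apply_self, hw₁, primeCycle_apply_self]
    · rw [primeCycle_apply_of_ne hx, primeCycle_apply_of_ne]
      intro h
      exact hx (ι.left.isClosedEmbedding.injective (h.trans hw₁.symm))
  refine ⟨w₁, a, ?_, ha, hprime, ?_⟩
  · rw [isLinearSubspacePoint_iff_base]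
    have e1 : ι.left w₁ = w' := hw₁
    rw [e1]
    exact hw'lin
  · change closure {ι.left w₁} = _
    rw [hw₁]
    exact hclw'

/-- A point of `V₊(Q)` on which `C` vanishes lies in `V₊(Q, C)`. [folklore] -/
theorem mem_range_quadricCubicToQuadric_of_mem (he : 0 < e) (hC : C ∈ grading (Fin (n + 1)) K e)
    (hC0 : C ≠ 0) (hCη : C ∉ (quadricι Q (genericPoint (quadric Q).left)).asHomogeneousIdeal)
    {x : ↥(quadric Q).left} (hx : C ∈ (quadricι Q x).asHomogeneousIdeal) : x ∈ Set.range (quadricCubicToQuadric Q C).left.base := by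
  rw [range_quadricCubicToQuadric_eq he hC hC0 hCη, Set.mem_setOf_eq, cubicSection,
    ProjSpace.avoids_pullbackAvoiding_formDivisor_iff _ he hC hC0, not_not]
  exact hx

omit [IsIntegral (quadric Q).left] in
/-- Restricting `a • [closure {i v}]` to `V₊(Q, C)` gives `a • [closure {v}]`. [folklore] -/
theorem cycleRestrictClosed_zsmul_primeCycle (a : ℤ) (v : ↥(quadricCubic Q C).left) :
    cycleRestrictClosed (quadricCubicToQuadric Q C).left (a • primeCycle ((quadricCubicToQuadric Q C).left v)) =
      a • primeCycle v := by
  ext y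
  rw [cycleRestrictClosed_apply, Function.locallyFinsuppWithin.coe_zsmul, Pi.smul_apply,
    Function.locallyFinsuppWithin.coe_zsmul, Pi.smul_apply]
  congr 1
  by_cases hy : y = v
  · subst hy
    rw [primeCycle_apply_self, primeCycle_apply_self]
  · rw [primeCycle_apply_of_ne hy, primeCycle_apply_of_ne]
    exact fun h => hy ((quadricCubicToQuadric Q C).left.isClosedEmbedding.injective h)

omit [IsIntegral (quadric Q).left] in
/-- A point `v` of `V₊(Q, C)` is an `r`-plane point (w.r.t. `V₊(Q, C) ↪ ℙⁿ`) iff its image in `V₊(Q)`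
is (w.r.t. `V₊(Q) ↪ ℙⁿ`). [folklore] -/
theorem isLinearSubspacePoint_quadricCubic_iff {r : ℕ} (v : ↥(quadricCubic Q C).left) :
    IsLinearSubspacePoint r n (completeIntersectionι ![Q, C]) v ↔
      IsLinearSubspacePoint r n (completeIntersectionι (fun _ : Fin 1 => Q)) ((quadricCubicToQuadric Q C).left v) := by
  rw [isLinearSubspacePoint_iff_base, isLinearSubspacePoint_iff_base (completeIntersectionι (fun _ : Fin 1 => Q))]
  have e1 : (completeIntersectionι ![Q, C]).left v =
      (completeIntersectionι (fun _ : Fin 1 => Q)).left ((quadricCubicToQuadric Q C).left v) := by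
    rw [← Scheme.Hom.comp_apply, ← Over.comp_left, quadricCubicToQuadric_ι]
  rw [e1]

/-! ### Strong planes not contained in `V₊(C)` -/

/-- **`Γ · Y = a • [Π ∩ V₊(ℓ)]`, `a > 0`, for a strong `(r+1)`-plane `Γ = Π ⊆ V₊(Q)` not contained in
`V₊(C)`** (Hirschowitz–Iyer, Lemma 2.2, case `s = r`: "Indeed, we have `Γ · Y = dW`"), at the level
of cycles: for an `(r+1)`-plane point `w` of `V₊(Q)` and a linear form `ℓ ∉ 𝔭_w` with
`Π ∩ V₊(C) = Π ∩ V₊(ℓ)` set-theoretically (`Π = closure {w}` in `ℙⁿ`), the cycle `V₊(C) · [Π]`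
restricted to `V₊(Q, C)` is `a • [closure {v}]` for an `r`-plane point `v` of `V₊(Q, C)` (the plane
`Π ∩ V₊(ℓ)`) and an integer `a > 0`. [cite: HirschowitzIyer2010, §2 Lemma 2.2 (case s = r)] -/
theorem quadricCubic_gysinCycle_primeCycle_eq_smul (he : 0 < e) (hC : C ∈ grading (Fin (n + 1)) K e) (hC0 : C ≠ 0)
    (hCη : C ∉ (quadricι Q (genericPoint (quadric Q).left)).asHomogeneousIdeal) {r : ℕ} (hr : 1 ≤ r) {w : ↥(quadric Q).left}
    (hw : IsLinearSubspacePoint r n (completeIntersectionι (fun _ : Fin 1 => Q)) w)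
    {ℓ : MvPolynomial (Fin (n + 1)) K} (hℓ : ℓ ∈ grading (Fin (n + 1)) K 1)
    (hℓw : ℓ ∉ (quadricι Q w).asHomogeneousIdeal)
    (hCℓ : closure {quadricι Q w} ∩
        ProjectiveSpectrum.zeroLocus (MvPolynomial.homogeneousSubmodule (Fin (n + 1)) K) {C} =
      closure {quadricι Q w} ∩
        ProjectiveSpectrum.zeroLocus (MvPolynomial.homogeneousSubmodule (Fin (n + 1)) K) {ℓ}) :
    ∃ (v : ↥(quadricCubic Q C).left) (a : ℤ),
      IsLinearSubspacePoint (r - 1) n (completeIntersectionι ![Q, C]) v ∧ 0 < a ∧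
        CartierDivisor.gysinCycle (quadricCubicToQuadric Q C).left (cubicSection he hC hC0 hCη)
          (primeCycle w) = a • primeCycle v ∧
        closure {quadricι Q ((quadricCubicToQuadric Q C).left v)} = closure {quadricι Q w} ∩
          ProjectiveSpectrum.zeroLocus (MvPolynomial.homogeneousSubmodule (Fin (n + 1)) K) {ℓ} := by
  obtain ⟨w₁, a, hw₁, ha, hprime, hcl⟩ := quadric_primeInter_formDivisor_eq_smul he hC hC0
    ((ProjSpace.formDivisor_avoids_iff hC hC0 he).2 hCη) hr hw hℓ hℓw hCℓ
  -- `w₁ ∈ V₊(Q, C)`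
  have hCw₁ : C ∈ (quadricι Q w₁).asHomogeneousIdeal := by
    have hmem : quadricι Q w₁ ∈ closure {quadricι Q w} ∩
        ProjectiveSpectrum.zeroLocus (MvPolynomial.homogeneousSubmodule (Fin (n + 1)) K) {ℓ} := by
      rw [← hcl]; exact subset_closure (Set.mem_singleton _)
    rw [← hCℓ] at hmem
    exact Set.singleton_subset_iff.1 ((ProjectiveSpectrum.mem_zeroLocus _ _ _).1 hmem.2)
  obtain ⟨v, hv⟩ := mem_range_quadricCubicToQuadric_of_mem he hC hC0 hCη hCw₁
  refine ⟨v, a, ?_, ha, ?_, by rw [hv]; exact hcl⟩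
  · rw [isLinearSubspacePoint_quadricCubic_iff]
    change IsLinearSubspacePoint (r - 1) n _ ((quadricCubicToQuadric Q C).left.base v)
    rw [hv]
    exact hw₁
  · rw [CartierDivisor.gysinCycle, CartierDivisor.interCycle_primeCycle]
    change cycleRestrictClosed _ ((cubicSection he hC hC0 hCη).primeInter w) = _
    rw [cubicSection, hprime]
    have hv' : (quadricCubicToQuadric Q C).left v = w₁ := hv
    rw [← hv']
    exact cycleRestrictClosed_zsmul_primeCycle a v

/-- **In `CH_r(V₊(Q, C))`: `quadricCubicGysin [Π] = a • [Π ∩ V₊(ℓ)]` with `a > 0`** for a strong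
`(r+1)`-plane `Π ⊆ V₊(Q)` not contained in `V₊(C)` (Hirschowitz–Iyer, Lemma 2.2, case `s = r`).
[cite: HirschowitzIyer2010, §2 Lemma 2.2 (case s = r)] -/
theorem quadricCubicGysin_mk_primeCycle_eq_smul (he : 0 < e) (hC : C ∈ grading (Fin (n + 1)) K e) (hC0 : C ≠ 0)
    (hCη : C ∉ (quadricι Q (genericPoint (quadric Q).left)).asHomogeneousIdeal) {r : ℕ} {w : ↥(quadric Q).left}
    (hw : IsLinearSubspacePoint (r + 1) n (completeIntersectionι (fun _ : Fin 1 => Q)) w)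
    {ℓ : MvPolynomial (Fin (n + 1)) K} (hℓ : ℓ ∈ grading (Fin (n + 1)) K 1)
    (hℓw : ℓ ∉ (quadricι Q w).asHomogeneousIdeal)
    (hCℓ : closure {quadricι Q w} ∩
        ProjectiveSpectrum.zeroLocus (MvPolynomial.homogeneousSubmodule (Fin (n + 1)) K) {C} =
      closure {quadricι Q w} ∩
        ProjectiveSpectrum.zeroLocus (MvPolynomial.homogeneousSubmodule (Fin (n + 1)) K) {ℓ}) :
    ∃ (v : ↥(quadricCubic Q C).left) (hv : IsLinearSubspacePoint r n (completeIntersectionι ![Q, C]) v) (a : ℤ),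
      0 < a ∧
        quadricCubicGysin he hC hC0 hCη r (QuotientAddGroup.mk ⟨primeCycle w, hw.primeCycle_mem⟩) =
          a • QuotientAddGroup.mk ⟨primeCycle v, hv.primeCycle_mem⟩ ∧
        closure {quadricι Q ((quadricCubicToQuadric Q C).left v)} = closure {quadricι Q w} ∩
          ProjectiveSpectrum.zeroLocus (MvPolynomial.homogeneousSubmodule (Fin (n + 1)) K) {ℓ} := by
  obtain ⟨v, a, hv, ha, hcyc, hcl⟩ := quadricCubic_gysinCycle_primeCycle_eq_smul he hC hC0 hCη
    (Nat.succ_le_succ (Nat.zero_le r)) hw hℓ hℓw hCℓ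
  refine ⟨v, by simpa using hv, a, ha, ?_, hcl⟩
  rw [quadricCubicGysin, CartierDivisor.IsEffective.gysin_mk]
  have hx : (⟨CartierDivisor.gysinCycle (quadricCubicToQuadric Q C).left (cubicSection he hC hC0 hCη) (primeCycle w),
      CartierDivisor.gysinCycle_mem_cyclesOfDim _ _ hw.primeCycle_mem⟩ : ↥(cyclesOfDim (quadricCubic Q C).left r)) =
      a • ⟨primeCycle v, hv.primeCycle_mem⟩ := Subtype.ext hcyc
  exact (congrArg QuotientAddGroup.mk hx).trans rfl

/-! ### Strong planes contained in `V₊(C)` -/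

/-- **`Γ · Y = a • [line]`, `a > 0`, in `CH_r(V₊(Q, C))`, for an `(r+1)`-plane `Γ = Π ⊆ V₊(Q)`
CONTAINED in `V₊(C)`** (Hirschowitz–Iyer, Lemma 2.2, case `s = r`, strong planes inside `Y`):
`quadricCubicGysin [Π] = a • [Π ∩ V₊(m)]` for ANY linear form `m` not vanishing on `Π` — the class of
`V₊(C)|_Π` is that of `V₊(mᵉ)|_Π` (`V₊(C) ∼ e • H ∼ V₊(mᵉ)` on `ℙⁿ`), whose cycle is a positive
multiple of the `r`-plane `Π ∩ V₊(m)` (`quadric_primeInter_formDivisor_eq_smul`); the difference of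
the two representatives of `V₊(C)|_Π` is rationally trivial on `Π ⊆ V₊(Q, C)`.
[cite: HirschowitzIyer2010, §2 Lemma 2.2 (case s = r)] -/
theorem quadricCubicGysin_mk_primeCycle_eq_smul_of_subset [LocallyOfFiniteType (quadric Q).hom]
    (he : 0 < e) (hC : C ∈ grading (Fin (n + 1)) K e) (hC0 : C ≠ 0)
    (hCη : C ∉ (quadricι Q (genericPoint (quadric Q).left)).asHomogeneousIdeal)
    {r : ℕ} {w : ↥(quadric Q).left}
    (hw : IsLinearSubspacePoint (r + 1) n (completeIntersectionι (fun _ : Fin 1 => Q)) w)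
    (hPi : closure {quadricι Q w} ⊆
      ProjectiveSpectrum.zeroLocus (MvPolynomial.homogeneousSubmodule (Fin (n + 1)) K) {C})
    {m : MvPolynomial (Fin (n + 1)) K} (hm : m ∈ grading (Fin (n + 1)) K 1)
    (hmw : m ∉ (quadricι Q w).asHomogeneousIdeal) :
    ∃ (v : ↥(quadricCubic Q C).left) (hv : IsLinearSubspacePoint r n (completeIntersectionι ![Q, C]) v) (a : ℤ),
      0 < a ∧
        quadricCubicGysin he hC hC0 hCη r (QuotientAddGroup.mk ⟨primeCycle w, hw.primeCycle_mem⟩) =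
          a • QuotientAddGroup.mk ⟨primeCycle v, hv.primeCycle_mem⟩ ∧
        closure {quadricι Q ((quadricCubicToQuadric Q C).left v)} = closure {quadricι Q w} ∩
          ProjectiveSpectrum.zeroLocus (MvPolynomial.homogeneousSubmodule (Fin (n + 1)) K) {m} := by
  classical
  set ι := completeIntersectionι (fun _ : Fin 1 => Q) with hιdef
  set i := quadricCubicToQuadric Q C with hidef
  set D := cubicSection he hC hC0 hCη with hD
  -- the form `G = m ^ e`
  have hG : m ^ e ∈ grading (Fin (n + 1)) K e := by
    simpa using SetLike.pow_mem_graded e hm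
  have hm0 : m ≠ 0 := fun h => hmw (h ▸ zero_mem _)
  have hG0 : m ^ e ≠ 0 := pow_ne_zero e hm0
  have hGw : m ^ e ∉ (quadricι Q w).asHomogeneousIdeal :=
    fun h => hmw ((quadricι Q w).isPrime.mem_of_pow_mem e h)
  have hGav : (ProjSpace.formDivisor _ hG hG0).Avoids (quadricι Q w) :=
    (ProjSpace.formDivisor_avoids_iff hG hG0 he).2 hGw
  have hGη : (ProjSpace.formDivisor _ hG hG0).Avoids (quadricι Q (genericPoint (quadric Q).left)) :=
    hGav.of_specializes ((quadricι Q).base.hom.map_specializes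
      ((genericPoint_spec (quadric Q).left).specializes (Set.mem_univ w)))
  have hzero : closure {quadricι Q w} ∩
      ProjectiveSpectrum.zeroLocus (MvPolynomial.homogeneousSubmodule (Fin (n + 1)) K) {m ^ e} =
      closure {quadricι Q w} ∩
        ProjectiveSpectrum.zeroLocus (MvPolynomial.homogeneousSubmodule (Fin (n + 1)) K) {m} := by
    rw [ProjectiveSpectrum.zeroLocus_singleton_pow _ _ _ he]
  obtain ⟨w₁, a, hw₁, ha, hprime, hcl⟩ := quadric_primeInter_formDivisor_eq_smul he hG hG0 hGη
    (Nat.succ_le_succ (Nat.zero_le r)) hw hm hmw hzero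
  set DG := (ProjSpace.formDivisor _ hG hG0).pullbackAvoiding (quadricι Q) hGη with hDG
  -- `closure {w} ⊆ V₊(Q, C)` (in `V₊(Q)`), in particular `w₁ = i v`
  have hclw : closure {w} ⊆ Set.range i.left.base := by
    intro x hx
    apply mem_range_quadricCubicToQuadric_of_mem he hC hC0 hCη
    have hιx : quadricι Q x ∈ closure {quadricι Q w} := by
      rw [← image_closure_singleton_of_isClosedMap (quadricι Q) (quadricι Q).isClosedMap w]
      exact ⟨x, hx, rfl⟩
    exact Set.singleton_subset_iff.1 ((ProjectiveSpectrum.mem_zeroLocus _ _ _).1 (hPi hιx))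
  have hw₁cl : w₁ ∈ closure {w} := by
    have h1 : quadricι Q w₁ ∈ closure {quadricι Q w} := by
      have h := (subset_closure (Set.mem_singleton (quadricι Q w₁)) : quadricι Q w₁ ∈ closure {quadricι Q w₁})
      rw [hcl] at h
      exact h.1
    rw [← image_closure_singleton_of_isClosedMap (quadricι Q) (quadricι Q).isClosedMap w] at h1
    obtain ⟨x, hx, hxe⟩ := h1
    rwa [← (quadricι Q).isClosedEmbedding.injective hxe]
  obtain ⟨v, hv⟩ := hclw hw₁cl
  -- the two representatives of `V₊(C)|_Π` and their cycles
  set O := ClosedSubvariety.ofPoint (quadric Q).left w with hO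
  have hOd : height (⊤ : ↥(O.over (quadric Q).hom).left) = r + 1 := by
    change height (⊤ : ↥(ClosedSubvariety.ofPoint (quadric Q).left w).carrier) = _
    rw [height_top_ofPoint, hw.height_eq]
    push_cast
    rfl
  have hDnav : ¬ D.Avoids (O.ι (genericPoint O.carrier)) := by
    change ¬ D.Avoids O.genericPoint
    rw [ClosedSubvariety.genericPoint_ofPoint]
    intro hav
    have hCw : C ∈ (quadricι Q w).asHomogeneousIdeal :=
      Set.singleton_subset_iff.1 ((ProjectiveSpectrum.mem_zeroLocus _ _ _).1
        (hPi (subset_closure (Set.mem_singleton _))))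
    exact ((ProjSpace.avoids_pullbackAvoiding_formDivisor_iff _ he hC hC0 _ w).1 hav) hCw
  have hGO : DG.Avoids (O.ι (genericPoint O.carrier)) := by
    change DG.Avoids O.genericPoint
    rw [ClosedSubvariety.genericPoint_ofPoint]
    exact CartierDivisor.Avoids.pullbackAvoiding_of_base (X := projectiveSpace n K) (quadricι Q) hGη hGav
  -- `D|_O ∼ DG|_O` (both represent the class of `V₊(C) ∼ V₊(m^e)` pulled back to `O`)
  have hlin : (D.pullbackRep O.ι).LinEquiv (DG.pullbackRep O.ι) := by
    have hCG : (ProjSpace.formDivisor C hC hC0).LinEquiv (ProjSpace.formDivisor _ hG hG0) :=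
      (ProjSpace.smul_hyperplane_linEquiv_formDivisor hC hC0).symm.trans
        (ProjSpace.smul_hyperplane_linEquiv_formDivisor hG hG0)
    have e1 : (D.pullbackRep O.ι).LinEquiv (D.classPullback O.ι) := (D.classPullback_linEquiv_pullbackRep O.ι).symm
    have e2 : (D.classPullback O.ι).LinEquiv (((ProjSpace.formDivisor C hC hC0).classPullback (quadricι Q)).classPullback O.ι) :=
      ((ProjSpace.formDivisor C hC hC0).classPullback_linEquiv_pullbackAvoiding (quadricι Q) _).symm.classPullback O.ι
    have e3 : (((ProjSpace.formDivisor C hC hC0).classPullback (quadricι Q)).classPullback O.ι).LinEquiv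
        ((ProjSpace.formDivisor C hC hC0).classPullback (O.ι ≫ quadricι Q)) :=
      ((ProjSpace.formDivisor C hC hC0).classPullback_comp_linEquiv (quadricι Q) O.ι).symm
    have e4 : ((ProjSpace.formDivisor C hC hC0).classPullback (O.ι ≫ quadricι Q)).LinEquiv
        ((ProjSpace.formDivisor _ hG hG0).classPullback (O.ι ≫ quadricι Q)) := hCG.classPullback _
    have e5 : ((ProjSpace.formDivisor _ hG hG0).classPullback (O.ι ≫ quadricι Q)).LinEquiv
        (((ProjSpace.formDivisor _ hG hG0).classPullback (quadricι Q)).classPullback O.ι) :=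
      (ProjSpace.formDivisor _ hG hG0).classPullback_comp_linEquiv (quadricι Q) O.ι
    have e6 : (((ProjSpace.formDivisor _ hG hG0).classPullback (quadricι Q)).classPullback O.ι).LinEquiv
        (DG.classPullback O.ι) :=
      ((ProjSpace.formDivisor _ hG hG0).classPullback_linEquiv_pullbackAvoiding (quadricι Q) hGη).classPullback O.ι
    have e7 : (DG.classPullback O.ι).LinEquiv (DG.pullbackRep O.ι) := DG.classPullback_linEquiv_pullbackRep O.ι
    exact (((((e1.trans e2).trans e3).trans e4).trans e5).trans e6).trans e7
  -- hence `D · [Π] - DG · [Π] ∈ Rat_r(V₊(Q); closure {w}) ⊆ Rat_r(V₊(Q); i(V₊(Q, C)))`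
  have hdiff : D.primeInter w - DG.primeInter w ∈ ratTrivialOn (quadric Q).left (Set.range i.left.base) r := by
    have h := (hlin.symm).cycle_sub_cycle_mem_ratTrivial (V := O.over (quadric Q).hom) hOd
    have h' := map_mem_ratTrivialOn_range_of_mem_ratTrivial O.ι h
    rw [ClosedSubvariety.range_ofPoint_ι] at h'
    refine ratTrivialOn_mono hclw ?_
    have key : D.primeInter w - DG.primeInter w = AlgebraicCycle.map O.ι height height
        ((D.pullbackRep O.ι).cycle - (DG.pullbackRep O.ι).cycle) := by
      rw [algebraicCycleMap_sub']
      rfl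
    rw [key]
    exact h'
  -- restrict to `V₊(Q, C)`
  have hrat : CartierDivisor.gysinCycle i.left D (primeCycle w) - a • primeCycle v ∈
      ratTrivial (quadricCubic Q C).left r := by
    have h := cycleRestrictClosed_mem_ratTrivial_of_mem_ratTrivialOn i.left hdiff
    rw [CartierDivisor.gysinCycle, CartierDivisor.interCycle_primeCycle]
    have hv' : i.left v = w₁ := hv
    have e1 : cycleRestrictClosed i.left (DG.primeInter w) = a • primeCycle v := by
      rw [hprime, ← hv']
      exact cycleRestrictClosed_zsmul_primeCycle a v
    have e2 : cycleRestrictClosed i.left (D.primeInter w) - a • primeCycle v =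
        cycleRestrictClosed i.left (D.primeInter w - DG.primeInter w) := by
      rw [← e1, ← cycleRestrictClosedHom_apply, ← cycleRestrictClosedHom_apply,
        ← cycleRestrictClosedHom_apply, map_sub]
    rw [e2]
    exact h
  have hvlin : IsLinearSubspacePoint r n (completeIntersectionι ![Q, C]) v := by
    rw [isLinearSubspacePoint_quadricCubic_iff]
    change IsLinearSubspacePoint r n _ (i.left.base v)
    rw [hv]
    simpa using hw₁
  refine ⟨v, hvlin, a, ha, ?_, by rw [hv]; exact hcl⟩
  rw [quadricCubicGysin, CartierDivisor.IsEffective.gysin_mk]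
  have hx : (QuotientAddGroup.mk (⟨CartierDivisor.gysinCycle (quadricCubicToQuadric Q C).left (cubicSection he hC hC0 hCη) (primeCycle w),
      CartierDivisor.gysinCycle_mem_cyclesOfDim _ _ hw.primeCycle_mem⟩ : ↥(cyclesOfDim (quadricCubic Q C).left r)) :
        ChowGroup (quadricCubic Q C).left r) =
      QuotientAddGroup.mk (a • ⟨primeCycle v, hvlin.primeCycle_mem⟩) := by
    apply (QuotientAddGroup.eq_iff_sub_mem).mpr
    exact hrat
  exact hx.trans rfl

end StrongPlane

end Literature.AlgebraicGeometry.Motives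

end
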